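import Summits.AnomalousDissipation.AnomalousDissipation.Theorems.SolenoidalFractalHomogenisationLagrangianStepCellChainLinks
import Literature.Analysis.FluidPDE.PassiveVectorTensorDistortedConstFrameFourier
import HarnessLib

/-!
# K1L_D `LagrangianRenormalisationStepDesign` (stmt-AnomalousDissipation-27980), registered stub `stub_D1_V0θg` (v28, ruling D28-3 (3)):
# the CHAIN ODE of every weak solution of the FROZEN-FRAME (constant distortion `G₀`) tensor cell problem, integrated form
# (helper; `--kind proof --supports stmt-AnomalousDissipation-27980 --as helper`)

Summits-side helper file of route `SolenoidalFractalHomogenisation` (prover seat `ad-k1l-cellLawV-w1` g9).  Everything proved; no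
definitions, no named facts, no sorry.  First Summits-side brick of the TWISTED sideband chain that the graded (V_θ) family
`VmodDist.SlowVectorClauseFθg … θV` (`…VmodDistortedDefs` AMENDMENT 2) asks the design to satisfy: its cell member is a weak solution of
`Torus.IsWeakTensorPassiveVectorDistortedOn 0 T ((1/n²)•𝔸) (cellField W M hM ν hν n) (fun _ _ => G₀) datum w` — the flat lattice cell
carrier, a CONSTANT frame `G₀`.  By `Literature/…/PassiveVectorTensorDistortedConstFrameFourier` such a frozen frame twists only the fibre
geometry of the flat chain: the constraint plane at `k` is `(G₀ᵀk)^⊥` and the viscous symbol is that of the conjugated tensor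
`Visc4.conj G₀ 𝔹`; the carrier, hence the SLOT LINKS of `…CellChainLinks` (`transport_pairing_cell`: `êⱼ·k` constant along each chain
`k + ℤKⱼ`, neighbours `k ∓ Kⱼ`, amplitudes `aⱼ, a′ⱼ`, envelopes `(1/n)trapⱼ`), is untouched.  Hence:

* `ae_inner_mFourierCoeff_eq_cell_frame` — **THE TWISTED CHAIN ODE, integrated form**: for every weak solution `u` of
  `IsWeakTensorPassiveVectorDistortedOn 0 T 𝔹 (W₁.cell n) (fun _ _ => G₀) F u` with `F ∈ L¹`, every `k` and every `z ∈ ℂ³` transversal to the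
  twisted frequency `G₀ᵀk` (`Σ_b ((k ᵥ* G₀)_b) z_b = 0`), for a.e. `t ∈ (0,T)`:
  `⟪û(t)(k), z⟫ = ⟪F̂(k), z⟫ + ∫_{(0,t]} ( −4π² ⟪û(τ)(k), T_{𝔹^{G₀}}(k) z⟫ + Σⱼ 2πi (êⱼ·k)(1/n)trapⱼ(τ)·(a′ⱼ ⟪û(τ)(k − Kⱼ), z⟫ + aⱼ ⟪û(τ)(k + Kⱼ), z⟫) ) dτ`
  — VERBATIM `ae_inner_mFourierCoeff_eq_cell` with the two substitutions `k·z = 0 ↦ (G₀ᵀk)·z = 0`, `T_𝔹 ↦ T_{conj G₀ 𝔹}`;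
* `ae_sum_vecMul_mul_mFourierCoeff_eq_zero_cell` — the modes of `u(t)` are transversal to the twisted frequencies (a.e. `t`, every `k`);
* `ae_inner_mFourierCoeff_eq_cell_frame_one` — consistency: at `G₀ = 1` the twisted identity is the flat one's statement for the
  distorted-class solution (same conclusion as `ae_inner_mFourierCoeff_eq_cell ∘ of_one_toFlat`).
`cellField W M hM ν hν n = W₁.cell n` for `W₁ = (W.stretch M).stretch (1/ν)` (`cellField_eq_cell`, `rfl`), so this IS the chain system of the cell
member of `SlowVectorClauseFθg`.  The continuous mode representatives with the twisted Leray projection `transversalProjR (twistFreq G₀ k)`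
(`Literature/…/PassiveVectorTensorTwistedModalSymbol`), their a.e. derivatives and the frozen-frame energy are the sequel files.
NOT a proof of `stub_D1_V0θg`, of K1L_D, or of anomalous dissipation; rung F-D1.A0 infrastructure.
-/

set_option linter.dupNamespace false

noncomputable section

namespace Summit.AnomalousDissipation.AnomalousDissipation.Theorems.SolenoidalFractalHomogenisation.LagrangianStep.CellChain

open Set MeasureTheory Filter Topology Function Complex UnitAddTorus
open scoped InnerProductSpace ComplexConjugate
open Literature.Analysis Literature.Analysis.FunctionSpaces Literature.Analysis.FunctionSpaces.Torus
open Literature.Analysis.FluidPDE Literature.Analysis.FluidPDE.LatticeShear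
open Summit.AnomalousDissipation.AnomalousDissipation.Theorems.SolenoidalFractalHomogenisation.RealisedQuasiStaticCellLaw
open Summit.AnomalousDissipation.AnomalousDissipation.Theorems.SolenoidalFractalHomogenisation.LagrangianStep

variable {k₀ : ℕ}

/-! ## §1 The twisted chain ODE of a weak solution, integrated form -/

/-- **THE TWISTED CHAIN ODE (integrated form) of every weak solution of the frozen-frame tensor cell problem.**  Let `u` be a weak
solution of `∂ₜu + (b·∇)u + G₀ᵀ∇π = 𝓛^{G₀}_𝔹 u`, `∇·(G₀ u) = 0` (`Torus.IsWeakTensorPassiveVectorDistortedOn`, constant frame `G₀`), along the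
cell carrier `b = W₁.cell n` of a lattice word, from an integrable datum `F`.  For every frequency `k` and every `z ∈ ℂ³` transversal to the
twisted frequency `G₀ᵀk` (`Σ_b (Σ_a k_a G₀ab) z_b = 0`), for a.e. `t ∈ (0,T)`:
`⟪û(t)(k), z⟫ = ⟪F̂(k), z⟫ + ∫_{(0,t]} ( −4π² ⟪û(τ)(k), T_{𝔹^{G₀}}(k) z⟫
   + Σⱼ 2πi (êⱼ·k)·(1/n)trapⱼ(τ)·(a′ⱼ ⟪û(τ)(k − Kⱼ), z⟫ + aⱼ ⟪û(τ)(k + Kⱼ), z⟫) ) dτ`, `𝔹^{G₀} = Visc4.conj G₀ 𝔹`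
— mode `k` is driven only by its two chain neighbours `k ∓ Kⱼ` of the slot(s) active at time `τ`, through the FLAT link factor `êⱼ·k`.
(`IsWeakTensorPassiveVectorDistortedOn.ae_inner_mFourierCoeff_eq_constFrame` + `transport_pairing_cell`.)
[cite: MeshalkinSinai1961, pp. 1700–1705] [cite: ArmstrongVicol2025, §4.1 (PDF p. 34)] -/
theorem ae_inner_mFourierCoeff_eq_cell_frame (W₁ : LatticeWord k₀) (n : ℕ) {T : ℝ} {𝔹 : Torus.Visc4 (Fin 3)}
    {G₀ : Matrix (Fin 3) (Fin 3) ℝ}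
    {F : UnitAddTorus (Fin 3) → EuclideanSpace ℝ (Fin 3)} {u : ℝ → UnitAddTorus (Fin 3) → EuclideanSpace ℝ (Fin 3)}
    (h : Torus.IsWeakTensorPassiveVectorDistortedOn 0 T 𝔹 (W₁.cell n) (fun _ _ => G₀) F u) (hF : Integrable F volume)
    (k : Fin 3 → ℤ) {z : EuclideanSpace ℂ (Fin 3)}
    (hz : ∑ b, ((Matrix.vecMul (fun a => (k a : ℝ)) G₀ b : ℝ) : ℂ) * z b = 0) :
    ∀ᵐ t ∂(volume.restrict (Ioo 0 T)),
      ⟪mFourierCoeff (EuclideanSpace.complexify ∘ u t) k, z⟫_ℂ =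
        ⟪mFourierCoeff (EuclideanSpace.complexify ∘ F) k, z⟫_ℂ +
        ∫ τ in Ioc 0 t,
          ((-(4 * Real.pi ^ 2 : ℝ) : ℂ) * ⟪mFourierCoeff (EuclideanSpace.complexify ∘ u τ) k, Torus.symbT (Torus.Visc4.conj G₀ 𝔹) k z⟫_ℂ +
            ∑ j, (2 * Real.pi * Complex.I * (∑ a, ((W₁.phase j).e a : ℂ) * (k a))) *
              (((1 / (n : ℝ)) * LatticeWord.trapezoid (W₁.start j) (W₁.phase j).τ W₁.ramp
                (Int.fract (τ / W₁.period) * W₁.period) : ℝ) : ℂ) *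
              ((starRingEnd ℂ (Complex.exp ((W₁.phase j).φ * Complex.I)) *
                    (-(1 / (2 * ((2 * Real.pi * ‖latticeVec (W₁.phase j).m‖ : ℝ) : ℂ) * Complex.I)))) *
                  ⟪mFourierCoeff (EuclideanSpace.complexify ∘ u τ) (k - fun i => (W₁.phase j).m i * n), z⟫_ℂ +
                (Complex.exp ((W₁.phase j).φ * Complex.I) *
                    (1 / (2 * ((2 * Real.pi * ‖latticeVec (W₁.phase j).m‖ : ℝ) : ℂ) * Complex.I))) *
                  ⟪mFourierCoeff (EuclideanSpace.complexify ∘ u τ) (k + fun i => (W₁.phase j).m i * n), z⟫_ℂ)) := by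
  have h1 := h.ae_inner_mFourierCoeff_eq_constFrame hF k hz
  have hsl' : ∀ᵐ τ ∂(volume : Measure ℝ), τ ∈ Ioo 0 T → Integrable (u τ) volume :=
    (ae_restrict_iff' measurableSet_Ioo).1 (h.ae_integrable_slice.mono fun τ hτ => hτ.1)
  filter_upwards [h1, ae_restrict_mem measurableSet_Ioo] with t ht htT
  rw [ht]
  congr 1
  refine setIntegral_congr_ae measurableSet_Ioc ?_
  filter_upwards [hsl'] with τ hτ hτI
  have hτ' : τ ∈ Ioo 0 T := ⟨hτI.1, lt_of_le_of_lt hτI.2 htT.2⟩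
  rw [transport_pairing_cell W₁ n τ (hτ hτ') k z, Complex.ofReal_zero, zero_mul, add_zero]

/-! ## §2 The twisted constraint along the chain -/

/-- **The modes of the frozen-frame cell solution are transversal to the twisted frequencies**: for a.e. `t ∈ (0,T)` and every `k`,
`Σ_b (Σ_a k_a G₀ab) û(t)(k)_b = 0` (`∇·(G₀ u(t)) = 0` weakly; `…DistortedConstFrameFourier` §5, by name in the cell setting).
[cite: RobinsonRodrigoSadowski2016, Ex. 2.14 (solution p. 310)] [cite: ArmstrongVicol2025, §4.1 (PDF p. 34)] -/
theorem ae_sum_vecMul_mul_mFourierCoeff_eq_zero_cell (W₁ : LatticeWord k₀) (n : ℕ) {T : ℝ} {𝔹 : Torus.Visc4 (Fin 3)}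
    {G₀ : Matrix (Fin 3) (Fin 3) ℝ}
    {F : UnitAddTorus (Fin 3) → EuclideanSpace ℝ (Fin 3)} {u : ℝ → UnitAddTorus (Fin 3) → EuclideanSpace ℝ (Fin 3)}
    (h : Torus.IsWeakTensorPassiveVectorDistortedOn 0 T 𝔹 (W₁.cell n) (fun _ _ => G₀) F u) :
    ∀ᵐ t ∂(volume.restrict (Ioo 0 T)), ∀ k : Fin 3 → ℤ,
      ∑ b, ((Matrix.vecMul (fun a => (k a : ℝ)) G₀ b : ℝ) : ℂ) * mFourierCoeff (EuclideanSpace.complexify ∘ u t) k b = 0 :=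
  h.ae_sum_vecMul_mul_mFourierCoeff_eq_zero

/-! ## §3 Consistency with the flat chain at `G₀ = 1` -/

/-- At the identity frame the twisted transversality is the flat one: `Σ_b ((k ᵥ* 1)_b) z_b = Σ_b k_b z_b`. [folklore] -/
theorem sum_vecMul_one_mul (k : Fin 3 → ℤ) (z : EuclideanSpace ℂ (Fin 3)) :
    ∑ b, ((Matrix.vecMul (fun a => (k a : ℝ)) (1 : Matrix (Fin 3) (Fin 3) ℝ) b : ℝ) : ℂ) * z b = ∑ j, (k j : ℂ) * z j := by
  refine Finset.sum_congr rfl fun b _ => ?_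
  rw [Matrix.vecMul_one]
  norm_cast

/-- **Consistency at `G₀ = 1`**: for a weak solution of the distorted class with the IDENTITY frame the twisted chain ODE is the flat chain
ODE of `…CellChainLinks.ae_inner_mFourierCoeff_eq_cell` (through `of_one_toFlat`; `conj 1 𝔹 = 𝔹`), for flat-transversal `z`.
[cite: MeshalkinSinai1961, pp. 1700–1705] -/
theorem ae_inner_mFourierCoeff_eq_cell_frame_one (W₁ : LatticeWord k₀) (n : ℕ) {T : ℝ} {𝔹 : Torus.Visc4 (Fin 3)}
    {F : UnitAddTorus (Fin 3) → EuclideanSpace ℝ (Fin 3)} {u : ℝ → UnitAddTorus (Fin 3) → EuclideanSpace ℝ (Fin 3)}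
    (h : Torus.IsWeakTensorPassiveVectorDistortedOn 0 T 𝔹 (W₁.cell n) (fun _ _ => (1 : Matrix (Fin 3) (Fin 3) ℝ)) F u)
    (hF : Integrable F volume) (k : Fin 3 → ℤ) {z : EuclideanSpace ℂ (Fin 3)} (hz : ∑ j, (k j : ℂ) * z j = 0) :
    ∀ᵐ t ∂(volume.restrict (Ioo 0 T)),
      ⟪mFourierCoeff (EuclideanSpace.complexify ∘ u t) k, z⟫_ℂ =
        ⟪mFourierCoeff (EuclideanSpace.complexify ∘ F) k, z⟫_ℂ +
        ∫ τ in Ioc 0 t,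
          ((-(4 * Real.pi ^ 2 : ℝ) : ℂ) * ⟪mFourierCoeff (EuclideanSpace.complexify ∘ u τ) k, Torus.symbT 𝔹 k z⟫_ℂ +
            ∑ j, (2 * Real.pi * Complex.I * (∑ a, ((W₁.phase j).e a : ℂ) * (k a))) *
              (((1 / (n : ℝ)) * LatticeWord.trapezoid (W₁.start j) (W₁.phase j).τ W₁.ramp
                (Int.fract (τ / W₁.period) * W₁.period) : ℝ) : ℂ) *
              ((starRingEnd ℂ (Complex.exp ((W₁.phase j).φ * Complex.I)) *
                    (-(1 / (2 * ((2 * Real.pi * ‖latticeVec (W₁.phase j).m‖ : ℝ) : ℂ) * Complex.I)))) *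
                  ⟪mFourierCoeff (EuclideanSpace.complexify ∘ u τ) (k - fun i => (W₁.phase j).m i * n), z⟫_ℂ +
                (Complex.exp ((W₁.phase j).φ * Complex.I) *
                    (1 / (2 * ((2 * Real.pi * ‖latticeVec (W₁.phase j).m‖ : ℝ) : ℂ) * Complex.I))) *
                  ⟪mFourierCoeff (EuclideanSpace.complexify ∘ u τ) (k + fun i => (W₁.phase j).m i * n), z⟫_ℂ)) :=
  ae_inner_mFourierCoeff_eq_cell W₁ n h.of_one_toFlat hF k hz

end Summit.AnomalousDissipation.AnomalousDissipation.Theorems.SolenoidalFractalHomogenisation.LagrangianStep.CellChain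

end
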